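import Mathlib
import Summits.MatrixMultiplication.Statement
import Summits.MatrixMultiplication.MatrixMultiplication.Theorems.GraphEquationsInitialIdeal

/-!
# The order-one rung: ideal initially isolated to order `1` ⇔ reduced (`GraphEquations`, kernel M13b)

Decomp-mm node «GraphEquations» (lens 5: base range + asymptotic regime + bridge); attacked leaf
`MultiplicityReduction`, open core `Purification` (M12).  Target VERBATIM: `_root_.MatrixMultiplication`.

The BASE RUNG of the staged split of `Purification` (line «purisplit»): BOUNDED-ORDER
PURIFICATION AT ORDER ONE IS A THEOREM, with the same exponent —

* `EqSystem.reducedAt_of_idealInitIsolatedAt_one`: if SOME finite family in the test ideal is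
  initially isolated to `I`-adic order `1` over `y`, the system is REDUCED at the graph point over
  `y` (the weight-`2` components of shifted ideal members are `ℂ`-combinations of those of the
  tests, whose `c`-coefficients are the `C`-Jacobian, M4; the specialised linear initial forms
  are read off by «purity is free», M13, and the injectivity of `F ↦ f`, M12);
* `eqAdmissibleIdealIso_one_iff_red : EqAdmissibleIdealIso β 1 ↔ EqAdmissibleRed β` — order one IS
  the currency of `H_red`; `eqAdmissiblePure_of_idealIso_one : EqAdmissibleIdealIso β 1 → EqAdmissiblePure β`
  and `boundedOrderPurification_one` (the rung `K = 1` of BOP′, for every `β' ≥ β`);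
* `EqAdmissiblePure.mono`, `EqAdmissibleIdealIso.mono` (exponent), `EqAdmissibleIdealIso.mono_order`.

No `sorry`.  Sources: [BurgisserClausenShokrollahi1997, Problem 16.3]; [Strassen1973].
-/

set_option linter.dupNamespace false

noncomputable section

open scoped BigOperators

namespace Summit.MatrixMultiplication.MatrixMultiplication.Theorems.GraphEquations

open MvPolynomial
open Literature.Computability.AlgebraicComplexity

variable {n : ℕ}

/-! ## Weight-2 components of ideal members -/

/-- `(g · t)_{(2)} = g(0) · t_{(2)}` for `t` in the ideal of the generators. -/
theorem weightedHomogeneousComponent_two_mul_of_mem {g t : MvPolynomial (GraphVars n) ℂ}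
    (ht : t ∈ graphIdeal n) :
    weightedHomogeneousComponent (gw n) 2 (g * t) = C (coeff 0 g) * weightedHomogeneousComponent (gw n) 2 t := by
  classical
  obtain ⟨c, hc⟩ := Ideal.mem_span_range_iff_exists_fun.mp ht
  rw [← hc, Finset.mul_sum, map_sum, map_sum, Finset.mul_sum]
  refine Finset.sum_congr rfl fun q _ => ?_
  rw [← mul_assoc, weightedHomogeneousComponent_two_mul_generator,
    weightedHomogeneousComponent_two_mul_generator, ← constantCoeff_eq]
  simp only [map_mul]
  ring

/-- `coeff 0 (θ_x g) = g(x)`. -/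
theorem coeff_zero_bind₁_shift (x : GraphVars n → ℂ) (g : MvPolynomial (GraphVars n) ℂ) :
    coeff 0 (bind₁ (shift x) g) = eval x g := by
  rw [← constantCoeff_eq, ← MvPolynomial.eval_zero (σ := GraphVars n) (R := ℂ), eval_bind₁_shift,
    shiftPoint_zero]

namespace EqSystem

/-- The weight-`2` component of a shifted TEST is the linear form `Σ_q J_C(x)_{o,q} f_q`. -/
theorem weightedHomogeneousComponent_two_shift_test {E : EqSystem n} (hE : E.Correct)
    {x : GraphVars n → ℂ} (hx : x ∈ mmGraph n) (o : Fin E.tests.length) :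
    weightedHomogeneousComponent (gw n) 2 (bind₁ (shift x) (E.testPoly (E.tests.get o))) =
      aeval (generator n) (∑ q : Fin n × Fin n, E.jacobianC x o q • (X q : MvPolynomial _ ℂ)) := by
  classical
  have hv : ∀ y ∈ mmGraph n, eval y (bind₁ (shift x) (E.testPoly (E.tests.get o))) = 0 :=
    fun y hy => eval_bind₁_shift_eq_zero hx
      (fun z hz => hE.eval_testPoly_eq_zero hz (List.get_mem _ _)) hy
  rw [weightedHomogeneousComponent_two_of_vanishing hv]
  simp only [map_sum, map_smul, aeval_X, coeff_inr_bind₁_shift]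
  rfl

/-- The weight-`2` component of a shifted IDEAL MEMBER `u = Σ_o h_o t_o` is the `ℂ`-combination
`Σ_o h_o(x) · (θ_x t_o)_{(2)}`. -/
theorem weightedHomogeneousComponent_two_shift_of_mem_span {E : EqSystem n} (hE : E.Correct)
    {x : GraphVars n → ℂ} (hx : x ∈ mmGraph n) {u : MvPolynomial (GraphVars n) ℂ}
    (hu : u ∈ Ideal.span (Set.range fun o : Fin E.tests.length => E.testPoly (E.tests.get o))) :
    ∃ c : Fin E.tests.length → ℂ,
      weightedHomogeneousComponent (gw n) 2 (bind₁ (shift x) u) =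
        aeval (generator n)
          (∑ o, c o • ∑ q : Fin n × Fin n, E.jacobianC x o q • (X q : MvPolynomial _ ℂ)) := by
  classical
  obtain ⟨h, hh⟩ := Ideal.mem_span_range_iff_exists_fun.mp hu
  refine ⟨fun o => eval x (h o), ?_⟩
  have hmem : ∀ o, bind₁ (shift x) (E.testPoly (E.tests.get o)) ∈ graphIdeal n := fun o =>
    mem_graphIdeal_of_vanishing fun y hy => eval_bind₁_shift_eq_zero hx
      (fun z hz => hE.eval_testPoly_eq_zero hz (List.get_mem _ _)) hy
  rw [← hh, map_sum, map_sum, map_sum]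
  refine Finset.sum_congr rfl fun o _ => ?_
  rw [map_mul, weightedHomogeneousComponent_two_mul_of_mem (hmem o), coeff_zero_bind₁_shift,
    weightedHomogeneousComponent_two_shift_test hE hx o, map_smul, smul_eq_C_mul]

/-! ## The rung: ideal initially isolated to order one ⇒ reduced -/

/-- **Ideal initially isolated to order `1` over `y` ⇒ REDUCED at the graph point over `y`.** -/
theorem reducedAt_of_idealInitIsolatedAt_one {E : EqSystem n} (hE : E.Correct)
    {y : MatMulVars n → ℂ} (h : E.IdealInitIsolatedAt 1 y) : E.ReducedAt (graphPoint y) := by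
  classical
  obtain ⟨T, u, hu, ν, G, hν, hG, hlow, hiso⟩ := h
  set x := graphPoint y with hxdef
  have hx : x ∈ mmGraph n := graphPoint_mem_mmGraph y
  -- the specialised initial forms, in terms of the Jacobian rows
  have hlin : ∀ i, ν i = 1 → ∃ c : Fin E.tests.length → ℂ,
      map (eval y) (homogeneousComponent (ν i) (G i)) =
        ∑ o, c o • ∑ q : Fin n × Fin n, E.jacobianC x o q • (X q : MvPolynomial _ ℂ) := fun i hi => by
    obtain ⟨c, hc⟩ := weightedHomogeneousComponent_two_shift_of_mem_span hE hx (hu i)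
    refine ⟨c, aeval_generator_injective ?_⟩
    rw [← hc, ← weightedHomogeneousComponent_shift_substF y (hlow i), hG i, hi]
  have hconst : ∀ i, ν i ≠ 1 → ∀ F₀ : Fin n × Fin n → ℂ,
      eval F₀ (map (eval y) (homogeneousComponent (ν i) (G i))) =
        eval 0 (map (eval y) (homogeneousComponent (ν i) (G i))) := fun i hi F₀ => by
    obtain h0 : ν i = 0 := by have := hν i; omega
    rw [h0, homogeneousComponent_zero, map_C, eval_C, eval_C]
  -- trivial kernel of the Jacobian
  have hker : ∀ F₀ : Fin n × Fin n → ℂ, (E.jacobianC x).mulVec F₀ = 0 → F₀ = 0 := by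
    intro F₀ hF
    have hrow : ∀ o, eval F₀ (∑ q : Fin n × Fin n, E.jacobianC x o q • (X q : MvPolynomial _ ℂ)) = 0 :=
        fun o => by
      have h := congr_fun hF o
      simp only [Matrix.mulVec, dotProduct, Pi.zero_apply] at h
      simpa [map_sum, smul_eval, eval_X] using h
    refine hiso F₀ fun i => ?_
    by_cases hi : ν i = 1
    · obtain ⟨c, hc⟩ := hlin i hi
      rw [hc]
      simp [map_sum, smul_eval, hrow]
    · exact hconst i hi F₀
  -- rank–nullity
  have hbot : LinearMap.ker (E.jacobianC x).mulVecLin = ⊥ := Matrix.ker_mulVecLin_eq_bot_iff.mpr hker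
  have h1 := LinearMap.finrank_range_add_finrank_ker (E.jacobianC x).mulVecLin
  rw [hbot, finrank_bot, add_zero] at h1
  show Module.finrank ℂ (LinearMap.range (E.jacobianC x).mulVecLin) = n * n
  rw [h1]
  simp

/-- Conversely, REDUCED at a graph point ⇒ tests (hence ideal) initially isolated to order `1`. -/
theorem idealInitIsolatedAt_one_of_reducedAt {E : EqSystem n} (hE : E.Correct)
    {y : MatMulVars n → ℂ} (h : E.ReducedAt (graphPoint y)) : E.IdealInitIsolatedAt 1 y :=
  (initIsolatedAt_one_of_pureIsolatedAt_two
    (fun _ _ hx => hE.eval_testPoly_eq_zero hx (List.get_mem _ _))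
    (pureIsolatedAt_two_of_reducedAt hE (graphPoint_mem_mmGraph y) h)).idealInitIsolatedAt

end EqSystem

/-! ## Family level: order one is the currency of `H_red` -/

/-- **`EqAdmissibleIdealIso β 1 ↔ EqAdmissibleRed β`.** -/
theorem eqAdmissibleIdealIso_one_iff_red {β : ℝ} : EqAdmissibleIdealIso β 1 ↔ EqAdmissibleRed β := by
  constructor
  · rintro ⟨c, hc⟩
    refine ⟨c, fun n hn => ?_⟩
    obtain ⟨E, hE, ⟨y, hy⟩, hcost⟩ := hc n hn
    exact ⟨E, hE, ⟨graphPoint y, graphPoint_mem_mmGraph y,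
      EqSystem.reducedAt_of_idealInitIsolatedAt_one hE hy⟩, hcost⟩
  · rintro ⟨c, hc⟩
    refine ⟨c, fun n hn => ?_⟩
    obtain ⟨E, hE, ⟨x, hx, hred⟩, hcost⟩ := hc n hn
    refine ⟨E, hE, ⟨fun v => x (Sum.inl v), ?_⟩, hcost⟩
    have hxg : graphPoint (fun v => x (Sum.inl v)) = x := graphPoint_eq_of_mem hx
    exact EqSystem.idealInitIsolatedAt_one_of_reducedAt hE (by rw [hxg]; exact hred)

/-- **The rung `K = 1` of bounded-order purification, same exponent.** -/
theorem eqAdmissiblePure_of_idealIso_one {β : ℝ} (h : EqAdmissibleIdealIso β 1) : EqAdmissiblePure β :=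
  eqAdmissiblePure_of_red (eqAdmissibleIdealIso_one_iff_red.mp h)

/-- Monotonicity of `EqAdmissiblePure` in the exponent. -/
theorem EqAdmissiblePure.mono {β β' : ℝ} (h : EqAdmissiblePure β) (hββ' : β ≤ β') :
    EqAdmissiblePure β' := by
  obtain ⟨K, c, hc⟩ := h
  refine ⟨K, max c 0, fun n hn => ?_⟩
  obtain ⟨E, hE, hpure, hcost⟩ := hc n hn
  refine ⟨E, hE, hpure, hcost.trans ?_⟩
  have hn1 : (1 : ℝ) ≤ n := by exact_mod_cast hn
  have h1 : (n : ℝ) ^ β ≤ (n : ℝ) ^ β' := Real.rpow_le_rpow_of_exponent_le hn1 hββ'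
  have h0 : 0 ≤ (n : ℝ) ^ β := Real.rpow_nonneg (by positivity) _
  calc c * (n : ℝ) ^ β ≤ max c 0 * (n : ℝ) ^ β := mul_le_mul_of_nonneg_right (le_max_left c 0) h0
    _ ≤ max c 0 * (n : ℝ) ^ β' := mul_le_mul_of_nonneg_left h1 (le_max_right c 0)

/-- Monotonicity of `EqAdmissibleIdealIso` in the exponent. -/
theorem EqAdmissibleIdealIso.mono {β β' : ℝ} {K : ℕ} (h : EqAdmissibleIdealIso β K) (hββ' : β ≤ β') :
    EqAdmissibleIdealIso β' K := by
  obtain ⟨c, hc⟩ := h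
  refine ⟨max c 0, fun n hn => ?_⟩
  obtain ⟨E, hE, hiso, hcost⟩ := hc n hn
  refine ⟨E, hE, hiso, hcost.trans ?_⟩
  have hn1 : (1 : ℝ) ≤ n := by exact_mod_cast hn
  have h1 : (n : ℝ) ^ β ≤ (n : ℝ) ^ β' := Real.rpow_le_rpow_of_exponent_le hn1 hββ'
  have h0 : 0 ≤ (n : ℝ) ^ β := Real.rpow_nonneg (by positivity) _
  calc c * (n : ℝ) ^ β ≤ max c 0 * (n : ℝ) ^ β := mul_le_mul_of_nonneg_right (le_max_left c 0) h0
    _ ≤ max c 0 * (n : ℝ) ^ β' := mul_le_mul_of_nonneg_left h1 (le_max_right c 0)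

/-- Monotonicity of `EqAdmissibleIdealIso` in the order. -/
theorem EqAdmissibleIdealIso.mono_order {β : ℝ} {K K' : ℕ} (h : EqAdmissibleIdealIso β K) (hKK' : K ≤ K') :
    EqAdmissibleIdealIso β K' := by
  obtain ⟨c, hc⟩ := h
  refine ⟨c, fun n hn => ?_⟩
  obtain ⟨E, hE, ⟨y, T, u, hu, ν, G, hν, hG, hlow, hiso⟩, hcost⟩ := hc n hn
  exact ⟨E, hE, ⟨y, T, u, hu, ν, G, fun o => (hν o).trans hKK', hG, hlow, hiso⟩, hcost⟩

/-- **BOP′(1): bounded-order purification at order one holds, for every `β' ≥ β`.** -/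
theorem boundedOrderPurification_one {β : ℝ} (h : EqAdmissibleIdealIso β 1) {β' : ℝ} (hββ' : β ≤ β') :
    EqAdmissiblePure β' :=
  (eqAdmissiblePure_of_idealIso_one h).mono hββ'

/-- Non-vacuity of the rung: `EqAdmissiblePure (5/2)` via order-one ideal isolation. -/
theorem eqAdmissiblePure_five_halves_via_rung : EqAdmissiblePure (5 / 2) :=
  eqAdmissiblePure_of_idealIso_one eqAdmissibleIdealIso_five_halves

end Summit.MatrixMultiplication.MatrixMultiplication.Theorems.GraphEquations
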